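import Summits.QuantumFields.YangMills.Theorems.BalabanUVNodesN15KingModelBoxSumRulesResolvent
import Summits.QuantumFields.YangMills.Theorems.BalabanUVNodesN15KingModelBoxGreenDiagonal
import HarnessLib

/-!
# BalabanUVNodes ∕ N15 — THE KING-MODEL RUNG (PART Ϟ-v): MASS-SHIFT AND COUPLING INEQUALITIES FOR THE FREE ENERGY DENSITIES — `(m′²−m²)·G_{m′²}(x,x) ≤ f(m′²) − f(m²) ≤
# (m′²−m²)·G_{m²}(x,x)` on every torus, on every box with free boundary conditions (with the averaged Neumann Green diagonal), and in infinite volume (with `K_∞(0)`); monotonicity in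
# the coupling `c` (`f` increases, the Green diagonals decrease) (Track A, DAG node N15 = NE2; FAN-OUT v1.1 §N15 s3 «KING-MODEL RUNG»; King (3.89) p.668, (4.4) p.670, §4 p.670; count-neutral)

HONEST FRAMING.  Count-neutral (cell `pub-ymgap`, seat `pub-ymgap-dag-n15-e` g41; K3ᴬ key **stmt-QuantumFields-27247** `--supports … --as helper` per KEY MAP v3).  TEMPLATE LITERATURE:
C. King, Commun. Math. Phys. **102** (1986) 649–677 [King1986]: (2.17) p.653, (3.89) p.668, (4.4) p.670 (`lapSym(q) = m² + cΣ(2−2cos p′_μ)`), (4.35) p.674, §4 p.670 l.8–13; T. Bałaban,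
Commun. Math. Phys. **89** (1983) 571–597 [Balaban1983RegularityDecay]: (2.43) p.584.  The elementary secant bounds `δ∕(σ+δ) ≤ ln(σ+δ) − ln σ ≤ δ∕σ` applied mode by mode to Ε-k's
`ln det = Σ_q ln lapSym(q)` (torus), Ϟ-c's `ln det_Ω = Σ_k ln lapSym(2n)(k̂)` (box), with Ε-e's `G(x,x) = |T|⁻¹Σ_q lapSym(q)⁻¹` and Ϟ-m's `|Ω|⁻¹Σ_sG^Ω(s,s) = |Ω|⁻¹Σ_k lapSym(2n)(k̂)⁻¹`; the
infinite-volume statements by passing to the limit along cubes (Ε-m `tendsto_log_det_lapF_div_card`, Ε-f `tendsto_lapF_inv_cube`).  THIS FILE: §0 `log_add_sub_log_bounds`; §1 TORUS ★★★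
**`log_det_lapF_div_card_sub_bounds`** (`(m′²−m²)G_{m′²}(x,x) ≤ f_T(m′²) − f_T(m²) ≤ (m′²−m²)G_{m²}(x,x)`), ★ `abs_log_det_lapF_div_card_sub_le` (mass-Lipschitz `≤ |m′²−m²|∕min`); §2 BOX ★★★
**`log_det_boxOp_div_card_sub_bounds`** (the same with `|Ω|⁻¹Σ_sG^Ω(s,s)`), ★ `abs_log_det_boxOp_div_card_sub_le`; §3 INFINITE VOLUME ★★★ **`kingFreeEnergyInf_sub_bounds`** (`(m′²−m²)K_∞(0;m′²) ≤
f_∞(m′²) − f_∞(m²) ≤ (m′²−m²)K_∞(0;m²)`), ★ `abs_kingFreeEnergyInf_sub_le`; §4 COUPLING `lapSym_mono_coupling`, ★★ `log_det_lapF_div_card_mono_coupling` (`c ≤ c′ ⇒ f_T(c) ≤ f_T(c′)`),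
★★ `lapF_inv_diag_anti_coupling` (`G_{c′}(x,x) ≤ G_c(x,x)`), ★★ `log_det_boxOp_div_card_mono_coupling`, ★★ `avg_kingBoxGreen_diag_anti_coupling`, ★★ `kingFreeEnergyInf_mono_coupling`,
★★ `freeKer_zero_anti_coupling`.

PRIOR TREE ART (named, USED not restated): Ε-k (`log_det_lapF`), Ε-e (`lapF_inv_diag_eq`), Ϟ-c (`log_det_boxOp`), Ϟ-m (`trace_boxOp_inv_eq_sum`, `trace_boxOp_inv_eq_sum_kingBoxGreen_diag`), Ϟ-s
(`lapSym_eq_add_mass`), Ε-m (`kingFreeEnergyInf`, `tendsto_log_det_lapF_div_card`), Ε-f (`tendsto_lapF_inv_cube`, `cubePt`), `King1986` (`lapF`, `lapSym`, `lapSym_ge`), `B5Prop11Plancherel`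
(`Tor`, `sOf`).  NOT Bałaban's covariant objects; NOT a node discharge (N15 is booked through n15-a's knit, untouched); nothing continuum-YM ∕ `ℝ⁴` ∕ OS ∕ Clay.  0 `sorry`; 0 `def`.

HONEST SCOPE.  King's `A = 0` free symbol ∕ operators; masses `0 < m² ≤ m′²`, couplings `0 ≤ c ≤ c′`; ONE-SIDED secant bounds (the sharp tangents are parts Ε-y∕Ϟ-m∕`…TorusFreeEnergyMassDerivative`).
Locators: [King1986] (2.17) p.653, (3.89) p.668, (4.4) p.670, (4.35) p.674, §4 p.670 l.8–13; [Balaban1983RegularityDecay] (2.43) p.584.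
-/

noncomputable section

open scoped BigOperators Topology
open Finset Filter

namespace Summit.QuantumFields.YangMills.BalabanUVNodes.N15KingModelRung.TorusSpectral

open Literature.MathematicalPhysics.QuantumFieldTheory.Balaban1983to89.B5Prop11Plancherel (Tor sOf)
open Literature.MathematicalPhysics.QuantumFieldTheory.King1986.Torus

variable {d : ℕ}

/-! ## §0 The secant bounds for the logarithm -/

/-- `δ∕(σ+δ) ≤ ln(σ+δ) − ln σ ≤ δ∕σ` for `σ > 0`, `δ ≥ 0`. [folklore] -/
theorem log_add_sub_log_bounds {σ δ : ℝ} (hσ : 0 < σ) (hδ : 0 ≤ δ) :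
    δ * (σ + δ)⁻¹ ≤ Real.log (σ + δ) - Real.log σ ∧ Real.log (σ + δ) - Real.log σ ≤ δ * σ⁻¹ := by
  have hσδ : 0 < σ + δ := by linarith
  rw [← Real.log_div hσδ.ne' hσ.ne']
  constructor
  · have h := Real.one_sub_inv_le_log_of_pos (div_pos hσδ hσ)
    rw [inv_div] at h
    have e : δ * (σ + δ)⁻¹ + σ / (σ + δ) = 1 := by rw [← div_eq_mul_inv, ← add_div, add_comm, div_self hσδ.ne']
    linarith
  · have h := Real.log_le_sub_one_of_pos (div_pos hσδ hσ)
    have e : (σ + δ) / σ = 1 + δ * σ⁻¹ := by rw [add_div, div_self hσ.ne', div_eq_mul_inv]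
    linarith

/-! ## §1 The torus -/

section Torus

variable (K : Fin (d + 1) → ℕ) [hK : ∀ i, NeZero (K i)] {c : ℝ}

/-- ★★★ **MASS-SHIFT BOUNDS ON THE TORUS**: for `0 < m² ≤ m′²` and every site `x`,
`(m′²−m²)·G_{m′²}(x,x) ≤ |T|⁻¹ln det(c(−Δ)+m′²) − |T|⁻¹ln det(c(−Δ)+m²) ≤ (m′²−m²)·G_{m²}(x,x)` (mode by mode). [cite: King1986, (3.89) p.668, (4.4) p.670, (4.35) p.674] -/
theorem log_det_lapF_div_card_sub_bounds (hc : 0 ≤ c) {m m' : ℝ} (hm : 0 < m) (hmm' : m ≤ m') (x : Tor K) :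
    (m' - m) * (lapF K c m')⁻¹ x x
        ≤ (Fintype.card (Tor K) : ℝ)⁻¹ * Real.log (lapF K c m').det - (Fintype.card (Tor K) : ℝ)⁻¹ * Real.log (lapF K c m).det
    ∧ (Fintype.card (Tor K) : ℝ)⁻¹ * Real.log (lapF K c m').det - (Fintype.card (Tor K) : ℝ)⁻¹ * Real.log (lapF K c m).det
        ≤ (m' - m) * (lapF K c m)⁻¹ x x := by
  have hm' : 0 < m' := lt_of_lt_of_le hm hmm'
  have hδ : 0 ≤ m' - m := by linarith
  have eσ : ∀ q : Tor K, lapSym K c m' q = lapSym K c m q + (m' - m) := fun q => by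
    rw [lapSym_eq_add_mass K c m' q, lapSym_eq_add_mass K c m q]; ring
  have hσ : ∀ q : Tor K, 0 < lapSym K c m q := fun q => lt_of_lt_of_le hm (lapSym_ge K c m hc q)
  have eR : (Fintype.card (Tor K) : ℝ)⁻¹ * Real.log (lapF K c m').det - (Fintype.card (Tor K) : ℝ)⁻¹ * Real.log (lapF K c m).det
      = (Fintype.card (Tor K) : ℝ)⁻¹ * ∑ q : Tor K, (Real.log (lapSym K c m q + (m' - m)) - Real.log (lapSym K c m q)) := by
    rw [log_det_lapF K hc hm, log_det_lapF K hc hm', ← mul_sub, ← Finset.sum_sub_distrib]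
    congr 1
    exact Finset.sum_congr rfl fun q _ => by rw [eσ q]
  have eL : ∀ {μ : ℝ} (hμ : 0 < μ), (m' - m) * (lapF K c μ)⁻¹ x x = (Fintype.card (Tor K) : ℝ)⁻¹ * ∑ q : Tor K, (m' - m) * (lapSym K c μ q)⁻¹ := fun hμ => by
    rw [lapF_inv_diag_eq K hc hμ x, mul_left_comm, Finset.mul_sum]
  have hcard : 0 ≤ (Fintype.card (Tor K) : ℝ)⁻¹ := by positivity
  rw [eR, eL hm', eL hm]
  refine ⟨mul_le_mul_of_nonneg_left (Finset.sum_le_sum fun q _ => ?_) hcard, mul_le_mul_of_nonneg_left (Finset.sum_le_sum fun q _ => ?_) hcard⟩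
  · rw [eσ q]
    exact (log_add_sub_log_bounds (hσ q) hδ).1
  · exact (log_add_sub_log_bounds (hσ q) hδ).2

/-- ★ **MASS-LIPSCHITZ BOUND FOR THE PERIODIC FREE ENERGY DENSITY**: `0 ≤ f_T(m′²) − f_T(m²) ≤ (m′²−m²)∕m²` for `0 < m² ≤ m′²`. [cite: King1986, (3.89) p.668, (4.4) p.670] -/
theorem log_det_lapF_div_card_sub_le (hc : 0 ≤ c) {m m' : ℝ} (hm : 0 < m) (hmm' : m ≤ m') :
    0 ≤ (Fintype.card (Tor K) : ℝ)⁻¹ * Real.log (lapF K c m').det - (Fintype.card (Tor K) : ℝ)⁻¹ * Real.log (lapF K c m).det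
    ∧ (Fintype.card (Tor K) : ℝ)⁻¹ * Real.log (lapF K c m').det - (Fintype.card (Tor K) : ℝ)⁻¹ * Real.log (lapF K c m).det ≤ (m' - m) * m⁻¹ := by
  have hm' : 0 < m' := lt_of_lt_of_le hm hmm'
  have h := log_det_lapF_div_card_sub_bounds K hc hm hmm' 0
  refine ⟨le_trans (mul_nonneg (by linarith) (ProperTime.lapF_inv_nonneg K hc hm' 0 0)) h.1, h.2.trans ?_⟩
  exact mul_le_mul_of_nonneg_left (lapF_inv_diag_le_inv_mass K hc hm 0) (by linarith)

end Torus

/-! ## §2 The box with free boundary conditions -/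

section Box

variable (n : Fin (d + 1) → ℕ) [hn : ∀ μ, NeZero (n μ)] {c : ℝ}

/-- the averaged Neumann Green diagonal in the cosine basis: `|Ω|⁻¹Σ_sG^Ω(s,s) = |Ω|⁻¹Σ_k lapSym(2n)(k̂)⁻¹`. [cite: King1986, (2.17) p.653, §4 p.670 l.8–13] -/
theorem avg_kingBoxGreen_diag_eq_sum (hc : 0 ≤ c) {m2 : ℝ} (hm : 0 < m2) :
    (Fintype.card (KingBox n) : ℝ)⁻¹ * ∑ s : KingBox n, kingBoxGreen n c m2 s s = (Fintype.card (KingBox n) : ℝ)⁻¹ * ∑ k : KingBox n, (lapSym (dblPer n) c m2 (dblBox n k))⁻¹ := by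
  rw [← trace_boxOp_inv_eq_sum_kingBoxGreen_diag n hc hm, trace_boxOp_inv_eq_sum n hc hm]

/-- ★★★ **MASS-SHIFT BOUNDS ON THE BOX**: for `0 < m² ≤ m′²`,
`(m′²−m²)·|Ω|⁻¹Σ_sG^Ω_{m′²}(s,s) ≤ |Ω|⁻¹ln det(c(−Δ_free)+m′²)_Ω − |Ω|⁻¹ln det(c(−Δ_free)+m²)_Ω ≤ (m′²−m²)·|Ω|⁻¹Σ_sG^Ω_{m²}(s,s)`. [cite: King1986, (3.89) p.668, §4 p.670 l.8–13] -/
theorem log_det_boxOp_div_card_sub_bounds (hc : 0 ≤ c) {m m' : ℝ} (hm : 0 < m) (hmm' : m ≤ m') :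
    (m' - m) * ((Fintype.card (KingBox n) : ℝ)⁻¹ * ∑ s : KingBox n, kingBoxGreen n c m' s s)
        ≤ (Fintype.card (KingBox n) : ℝ)⁻¹ * Real.log (boxOp n c m').det - (Fintype.card (KingBox n) : ℝ)⁻¹ * Real.log (boxOp n c m).det
    ∧ (Fintype.card (KingBox n) : ℝ)⁻¹ * Real.log (boxOp n c m').det - (Fintype.card (KingBox n) : ℝ)⁻¹ * Real.log (boxOp n c m).det
        ≤ (m' - m) * ((Fintype.card (KingBox n) : ℝ)⁻¹ * ∑ s : KingBox n, kingBoxGreen n c m s s) := by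
  have hm' : 0 < m' := lt_of_lt_of_le hm hmm'
  have hδ : 0 ≤ m' - m := by linarith
  have eσ : ∀ k : KingBox n, lapSym (dblPer n) c m' (dblBox n k) = lapSym (dblPer n) c m (dblBox n k) + (m' - m) := fun k => by
    rw [lapSym_eq_add_mass (dblPer n) c m', lapSym_eq_add_mass (dblPer n) c m]; ring
  have hσ : ∀ k : KingBox n, 0 < lapSym (dblPer n) c m (dblBox n k) := fun k => lt_of_lt_of_le hm (lapSym_ge (dblPer n) c m hc _)
  have eR : (Fintype.card (KingBox n) : ℝ)⁻¹ * Real.log (boxOp n c m').det - (Fintype.card (KingBox n) : ℝ)⁻¹ * Real.log (boxOp n c m).det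
      = (Fintype.card (KingBox n) : ℝ)⁻¹ * ∑ k : KingBox n, (Real.log (lapSym (dblPer n) c m (dblBox n k) + (m' - m)) - Real.log (lapSym (dblPer n) c m (dblBox n k))) := by
    rw [log_det_boxOp n hc hm, log_det_boxOp n hc hm', ← mul_sub, ← Finset.sum_sub_distrib]
    congr 1
    exact Finset.sum_congr rfl fun k _ => by rw [eσ k]
  have eL : ∀ {μ : ℝ} (hμ : 0 < μ), (m' - m) * ((Fintype.card (KingBox n) : ℝ)⁻¹ * ∑ s : KingBox n, kingBoxGreen n c μ s s)
      = (Fintype.card (KingBox n) : ℝ)⁻¹ * ∑ k : KingBox n, (m' - m) * (lapSym (dblPer n) c μ (dblBox n k))⁻¹ := fun hμ => by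
    rw [avg_kingBoxGreen_diag_eq_sum n hc hμ, mul_left_comm, Finset.mul_sum]
  have hcard : 0 ≤ (Fintype.card (KingBox n) : ℝ)⁻¹ := by positivity
  rw [eR, eL hm', eL hm]
  refine ⟨mul_le_mul_of_nonneg_left (Finset.sum_le_sum fun k _ => ?_) hcard, mul_le_mul_of_nonneg_left (Finset.sum_le_sum fun k _ => ?_) hcard⟩
  · rw [eσ k]
    exact (log_add_sub_log_bounds (hσ k) hδ).1
  · exact (log_add_sub_log_bounds (hσ k) hδ).2

/-- ★ **MASS-LIPSCHITZ BOUND ON THE BOX**: `0 ≤ f_Ω(m′²) − f_Ω(m²) ≤ (m′²−m²)∕m²`. [cite: King1986, (3.89) p.668, §4 p.670 l.8–13] -/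
theorem log_det_boxOp_div_card_sub_le (hc : 0 ≤ c) {m m' : ℝ} (hm : 0 < m) (hmm' : m ≤ m') :
    0 ≤ (Fintype.card (KingBox n) : ℝ)⁻¹ * Real.log (boxOp n c m').det - (Fintype.card (KingBox n) : ℝ)⁻¹ * Real.log (boxOp n c m).det
    ∧ (Fintype.card (KingBox n) : ℝ)⁻¹ * Real.log (boxOp n c m').det - (Fintype.card (KingBox n) : ℝ)⁻¹ * Real.log (boxOp n c m).det ≤ (m' - m) * m⁻¹ := by
  have hm' : 0 < m' := lt_of_lt_of_le hm hmm'
  have h := log_det_boxOp_div_card_sub_bounds n hc hm hmm'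
  have h0 : 0 ≤ (Fintype.card (KingBox n) : ℝ)⁻¹ * ∑ s : KingBox n, kingBoxGreen n c m' s s :=
    mul_nonneg (by positivity) (Finset.sum_nonneg fun s _ => kingBoxGreen_nonneg n hc hm' s s)
  refine ⟨le_trans (mul_nonneg (by linarith) h0) h.1, h.2.trans ?_⟩
  exact mul_le_mul_of_nonneg_left (avg_kingBoxGreen_diag_bounds n hc hm).2 (by linarith)

end Box

/-! ## §3 Infinite volume, by passing to the limit along cubes -/

section Infinite

variable {c : ℝ}

/-- the cube sides `N+1` diverge. [folklore] -/
theorem tendsto_cube_side : Tendsto (fun k : ℕ => (((fun _ : Fin (d + 1) => k + 1) (0 : Fin (d + 1)) : ℕ) : ℝ)) atTop atTop := by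
  simp only
  exact tendsto_natCast_atTop_atTop.comp (tendsto_add_atTop_nat 1)

/-- ★★★ **MASS-SHIFT BOUNDS IN INFINITE VOLUME**: `(m′²−m²)·K_∞(0;m′²) ≤ f_∞(m′²) − f_∞(m²) ≤ (m′²−m²)·K_∞(0;m²)` for `0 < m² ≤ m′²` (the torus bounds along the cubes
`(ℤ∕(N+1))^{d+1}`, `N → ∞`). [cite: King1986, (3.89) p.668, (4.4) p.670; Balaban1983RegularityDecay, (2.43) p.584] -/
theorem kingFreeEnergyInf_sub_bounds (hc : 0 ≤ c) {m m' : ℝ} (hm : 0 < m) (hmm' : m ≤ m') :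
    (m' - m) * freeKer c m' (0 : Fin (d + 1) → ℤ) ≤ kingFreeEnergyInf c m' d - kingFreeEnergyInf c m d
    ∧ kingFreeEnergyInf c m' d - kingFreeEnergyInf c m d ≤ (m' - m) * freeKer c m (0 : Fin (d + 1) → ℤ) := by
  have hm' : 0 < m' := lt_of_lt_of_le hm hmm'
  have hpos : ∀ (k : ℕ) (ν : Fin (d + 1)), 0 < (fun _ : Fin (d + 1) => k + 1) ν := fun k ν => Nat.succ_pos k
  have hlim : ∀ ν : Fin (d + 1), Tendsto (fun k : ℕ => (((fun _ : Fin (d + 1) => k + 1) ν : ℕ) : ℝ)) atTop atTop := fun ν =>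
    tendsto_natCast_atTop_atTop.comp (tendsto_add_atTop_nat 1)
  have hf : ∀ {μ : ℝ} (hμ : 0 < μ), Tendsto (fun k : ℕ => (Fintype.card (Tor (fun _ : Fin (d + 1) => k + 1)) : ℝ)⁻¹ * Real.log (lapF (fun _ : Fin (d + 1) => k + 1) c μ).det)
      atTop (𝓝 (kingFreeEnergyInf c μ d)) := fun hμ => tendsto_log_det_lapF_div_card hc hμ (fun k _ => k + 1) hpos hlim
  have hG : ∀ {μ : ℝ} (hμ : 0 < μ), Tendsto (fun k : ℕ => (lapF (fun _ : Fin (d + 1) => k + 1) c μ)⁻¹ (cubePt k 0) 0) atTop (𝓝 (freeKer c μ (0 : Fin (d + 1) → ℤ))) :=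
    fun hμ => tendsto_lapF_inv_cube hc hμ 0
  have h0 : ∀ k : ℕ, cubePt (d := d) k 0 = 0 := fun k => by funext μ; simp [cubePt]
  constructor
  · refine le_of_tendsto_of_tendsto' ((hG hm').const_mul (m' - m)) ((hf hm').sub (hf hm)) fun k => ?_
    rw [h0 k]
    exact (log_det_lapF_div_card_sub_bounds (fun _ : Fin (d + 1) => k + 1) hc hm hmm' 0).1
  · refine le_of_tendsto_of_tendsto' ((hf hm').sub (hf hm)) ((hG hm).const_mul (m' - m)) fun k => ?_
    rw [h0 k]
    exact (log_det_lapF_div_card_sub_bounds (fun _ : Fin (d + 1) => k + 1) hc hm hmm' 0).2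

/-- ★ **MASS-LIPSCHITZ BOUND FOR `f_∞`**: `0 ≤ f_∞(m′²) − f_∞(m²) ≤ (m′²−m²)∕m²`. [cite: King1986, (3.89) p.668, (4.4) p.670] -/
theorem kingFreeEnergyInf_sub_le (hc : 0 ≤ c) {m m' : ℝ} (hm : 0 < m) (hmm' : m ≤ m') :
    0 ≤ kingFreeEnergyInf c m' d - kingFreeEnergyInf c m d ∧ kingFreeEnergyInf c m' d - kingFreeEnergyInf c m d ≤ (m' - m) * m⁻¹ := by
  have hm' : 0 < m' := lt_of_lt_of_le hm hmm'
  have h := kingFreeEnergyInf_sub_bounds (d := d) hc hm hmm'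
  refine ⟨le_trans (mul_nonneg (by linarith) (freeKer_nonneg hc hm' 0)) h.1, h.2.trans ?_⟩
  exact mul_le_mul_of_nonneg_left (freeKer_zero_le_inv_mass hc hm) (by linarith)

end Infinite

/-! ## §4 Monotonicity in the coupling -/

section Coupling

variable (K : Fin (d + 1) → ℕ) [hK : ∀ i, NeZero (K i)]

omit hK in
/-- the symbol increases with the coupling: `c ≤ c′ ⇒ lapSym K c m² q ≤ lapSym K c′ m² q`. [cite: King1986, (4.4) p.670] -/
theorem lapSym_mono_coupling {c c' : ℝ} (hcc' : c ≤ c') (m2 : ℝ) (q : Tor K) : lapSym K c m2 q ≤ lapSym K c' m2 q := by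
  unfold lapSym
  have hS : 0 ≤ ∑ μ, (2 - 2 * Real.cos (sOf K q μ)) := Finset.sum_nonneg fun μ _ => by linarith [Real.cos_le_one (sOf K q μ)]
  nlinarith

/-- ★★ **THE PERIODIC FREE ENERGY DENSITY INCREASES WITH THE COUPLING**: `0 ≤ c ≤ c′ ⇒ f_T(c,m²) ≤ f_T(c′,m²)`. [cite: King1986, (3.89) p.668, (4.4) p.670] -/
theorem log_det_lapF_div_card_mono_coupling {c c' : ℝ} (hc : 0 ≤ c) (hcc' : c ≤ c') {m2 : ℝ} (hm : 0 < m2) :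
    (Fintype.card (Tor K) : ℝ)⁻¹ * Real.log (lapF K c m2).det ≤ (Fintype.card (Tor K) : ℝ)⁻¹ * Real.log (lapF K c' m2).det := by
  rw [log_det_lapF K hc hm, log_det_lapF K (hc.trans hcc') hm]
  refine mul_le_mul_of_nonneg_left (Finset.sum_le_sum fun q _ => Real.log_le_log (lt_of_lt_of_le hm (lapSym_ge K c m2 hc q)) (lapSym_mono_coupling K hcc' m2 q)) (by positivity)

/-- ★★ **THE PERIODIC VARIANCE DECREASES WITH THE COUPLING**: `0 ≤ c ≤ c′ ⇒ G_{c′}(x,x) ≤ G_c(x,x)`. [cite: King1986, (2.17) p.653, (4.4) p.670, (4.35) p.674] -/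
theorem lapF_inv_diag_anti_coupling {c c' : ℝ} (hc : 0 ≤ c) (hcc' : c ≤ c') {m2 : ℝ} (hm : 0 < m2) (x : Tor K) :
    (lapF K c' m2)⁻¹ x x ≤ (lapF K c m2)⁻¹ x x := by
  rw [lapF_inv_diag_eq K hc hm x, lapF_inv_diag_eq K (hc.trans hcc') hm x]
  refine mul_le_mul_of_nonneg_left (Finset.sum_le_sum fun q _ => inv_anti₀ (lt_of_lt_of_le hm (lapSym_ge K c m2 hc q)) (lapSym_mono_coupling K hcc' m2 q)) (by positivity)

variable (n : Fin (d + 1) → ℕ) [hn : ∀ μ, NeZero (n μ)]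

omit hK in
/-- ★★ **THE FREE-BOUNDARY FREE ENERGY DENSITY INCREASES WITH THE COUPLING**. [cite: King1986, (3.89) p.668, §4 p.670 l.8–13] -/
theorem log_det_boxOp_div_card_mono_coupling {c c' : ℝ} (hc : 0 ≤ c) (hcc' : c ≤ c') {m2 : ℝ} (hm : 0 < m2) :
    (Fintype.card (KingBox n) : ℝ)⁻¹ * Real.log (boxOp n c m2).det ≤ (Fintype.card (KingBox n) : ℝ)⁻¹ * Real.log (boxOp n c' m2).det := by
  rw [log_det_boxOp n hc hm, log_det_boxOp n (hc.trans hcc') hm]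
  refine mul_le_mul_of_nonneg_left (Finset.sum_le_sum fun k _ =>
    Real.log_le_log (lt_of_lt_of_le hm (lapSym_ge (dblPer n) c m2 hc _)) (lapSym_mono_coupling (dblPer n) hcc' m2 _)) (by positivity)

omit hK in
/-- ★★ **THE AVERAGED NEUMANN VARIANCE DECREASES WITH THE COUPLING**: `|Ω|⁻¹Σ_sG^Ω_{c′}(s,s) ≤ |Ω|⁻¹Σ_sG^Ω_c(s,s)`. [cite: King1986, (2.17) p.653, §4 p.670 l.8–13] -/
theorem avg_kingBoxGreen_diag_anti_coupling {c c' : ℝ} (hc : 0 ≤ c) (hcc' : c ≤ c') {m2 : ℝ} (hm : 0 < m2) :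
    (Fintype.card (KingBox n) : ℝ)⁻¹ * ∑ s : KingBox n, kingBoxGreen n c' m2 s s ≤ (Fintype.card (KingBox n) : ℝ)⁻¹ * ∑ s : KingBox n, kingBoxGreen n c m2 s s := by
  rw [avg_kingBoxGreen_diag_eq_sum n hc hm, avg_kingBoxGreen_diag_eq_sum n (hc.trans hcc') hm]
  refine mul_le_mul_of_nonneg_left (Finset.sum_le_sum fun k _ =>
    inv_anti₀ (lt_of_lt_of_le hm (lapSym_ge (dblPer n) c m2 hc _)) (lapSym_mono_coupling (dblPer n) hcc' m2 _)) (by positivity)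

omit hK hn in
/-- ★★ **`f_∞` INCREASES WITH THE COUPLING** (limit of the torus statement along cubes). [cite: King1986, (3.89) p.668, (4.4) p.670] -/
theorem kingFreeEnergyInf_mono_coupling {c c' : ℝ} (hc : 0 ≤ c) (hcc' : c ≤ c') {m2 : ℝ} (hm : 0 < m2) :
    kingFreeEnergyInf c m2 d ≤ kingFreeEnergyInf c' m2 d := by
  have hpos : ∀ (k : ℕ) (ν : Fin (d + 1)), 0 < (fun _ : Fin (d + 1) => k + 1) ν := fun k ν => Nat.succ_pos k
  have hlim : ∀ ν : Fin (d + 1), Tendsto (fun k : ℕ => (((fun _ : Fin (d + 1) => k + 1) ν : ℕ) : ℝ)) atTop atTop := fun ν =>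
    tendsto_natCast_atTop_atTop.comp (tendsto_add_atTop_nat 1)
  exact le_of_tendsto_of_tendsto' (tendsto_log_det_lapF_div_card hc hm (fun k _ => k + 1) hpos hlim)
    (tendsto_log_det_lapF_div_card (hc.trans hcc') hm (fun k _ => k + 1) hpos hlim)
    fun k => log_det_lapF_div_card_mono_coupling (fun _ : Fin (d + 1) => k + 1) hc hcc' hm

omit hK hn in
/-- ★★ **`K_∞(0)` DECREASES WITH THE COUPLING** (limit of the torus statement along cubes). [cite: Balaban1983RegularityDecay, (2.43) p.584; King1986, (4.4) p.670] -/
theorem freeKer_zero_anti_coupling {c c' : ℝ} (hc : 0 ≤ c) (hcc' : c ≤ c') {m2 : ℝ} (hm : 0 < m2) :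
    freeKer c' m2 (0 : Fin (d + 1) → ℤ) ≤ freeKer c m2 (0 : Fin (d + 1) → ℤ) := by
  have h0 : ∀ k : ℕ, cubePt (d := d) k 0 = 0 := fun k => by funext μ; simp [cubePt]
  refine le_of_tendsto_of_tendsto' (tendsto_lapF_inv_cube (hc.trans hcc') hm 0) (tendsto_lapF_inv_cube hc hm 0) fun k => ?_
  rw [h0 k]
  exact lapF_inv_diag_anti_coupling (fun _ : Fin (d + 1) => k + 1) hc hcc' hm 0

end Coupling

end Summit.QuantumFields.YangMills.BalabanUVNodes.N15KingModelRung.TorusSpectral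

end
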